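import Summits.QuantumFields.BalabanUV.Beta.D1BFx.NeedleDipShape

/-!
# `BalabanUV.Beta.D1BFx.NeedleDipDipPointwise` — road «BF-x» for binder row D1, slot (K), END row `hGrp gN`, «GN-33∕KK» PART 1: THE `dip ⊗ dip` WORD,
# POINTWISE, FROM ABSTRACT PAIRING LETTERS — sixteen products of two pairings booked into THREE SHAPES `Z₀·e^{−(η∕n)‖u−v‖} + Z₁·e∕nrm(u−v) + Z₂·e∕nrm(u−v)²`

HONEST DEPENDENCY (cell records, verbatim): «continuum YM on T⁴ ⇐ BetaPertH ∧ nine spine estimates (0/9 proved); BetaPertH ⇐ (D1) ∧ (D4) ∧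
CAP+tail; G-an2-4 gates asym, D1 and NE2/3/4.»  HONEST FRAMING (cell contract, verbatim): «discharging `BetaPertH` makes Bałaban's UV stability
UNCONDITIONAL — a real constructive-QFT result; it is NOT the continuum limit and NOT the Clay problem.»  THIS MODULE DISCHARGES NOTHING of the
wall: [folklore] bookkeeping over leaf-04-g9's `NeedleDipShape.bubble_dip_expand_right` ∕ `bubble_dip_dSw` (the sixteen terms) with ABSTRACT pairing letters
as HYPOTHESES (twelve damped types `X·e^{−(η∕n)‖u−v‖}`, the Coulomb types `Y₁ + Y₂∕nrm`, `Y₃∕nrm`, and the `(δρ,δρ′)` type `Y₄∕nrm² + Y₅`).  No `def`,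
no `def … : Prop`, nothing cited, 0 sorry.  Root-level binders hW ∕ hR-sockets ∕ hSX-socket ∕ D1Tel ∕ D1Rep — 0 discharged; (K) NOT closed; NOT D1,
NOT `BetaPertH`, NOT continuum, NOT Clay.

WHY (owner RULING ρ-g10-5 (a) «GN-33∕KK → leaf-04-g9»; an3-g59 §3′ (4) R2⊗R2; leaf-04-g9's 16-term ledger, journal 2026-08-21T11:16Z).  With
`g = (p, δp, δρ, ρ)`, `f = (δρ, ρ, p, δp)` the word at bonds `(u,μ)`, `(v,ν)` is `Σ_{i,j} s_is_j·⟨∇g_i|_u, Ga∇f_j|_v⟩·⟨∇g_j|_v, Ga∇f_i|_u⟩`; every term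
has at least one damped factor, and the three Coulomb-type factors only ever meet a damped co-factor — hence the three shapes.

CONTENT (`a > 0`, `n ≥ 1`, a spread leg `Ga n a`).
* §1 [folklore] `abs_comb4_le` (`|a₁b₁ + a₂b₂ − a₃b₃ − a₄b₄| ≤ Σ|aᵢ||bᵢ|`), `mul_damped_le` (two damped letters multiply to one).
* §2 [folklore] **`abs_dipDip_word_le`** — `|bubble (Ga n a) (dipPiece n a μ u) (dipPiece n a ν v)| ≤ Z₀·E + Z₁·E∕nrm(u−v) + Z₂·E∕nrm(u−v)²`,
  `E = e^{−(η∕n)‖u−v‖∞}`, `Z₀ = X_{pD}² + 2X_{pR}X_{dPD} + 2X_{PP}Y₅ + X_{dPR}² + 2X_{dPdP}Y₁ + X_{DP}² + 2X_{DdP}X_{RP} + X_{RdP}²`,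
  `Z₁ = 2(X_{PdP} + X_{dPP})Y₃ + 2X_{dPdP}Y₂`, `Z₂ = 2X_{PP}Y₄`.
NOT HERE (honest): any letter; the (1.22) sum and the cell (PART 2 `NeedleDipDipRow`).
Unit `b2b-balaban-beta-d1-formalise-leaf-04` (gen 9); `LEAVES-BFx.md` row (N) «GN-33∕KK» PART 1.
-/

noncomputable section

namespace Summit.QuantumFields.BalabanUV.Beta.D1BFx.NeedleDipDipPointwise

open Finset
open scoped BigOperators
open Literature.MathematicalPhysics.QuantumFieldTheory.Balaban1983to89
open Literature.MathematicalPhysics.QuantumFieldTheory.Balaban1983to89.Beta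
open ExpKernelCalculus (Site MKer bubble)
open AffineAveraging (unitVec)
open PoissonInterior (nrm nrm_pos one_le_nrm nrm_neg supNorm supNorm_neg)
open Summit.QuantumFields.BalabanUV.Beta.TameKernelCalculus (Spr)
open Summit.QuantumFields.BalabanUV.Beta.D1BFx.RProjector (Pgt)
open Summit.QuantumFields.BalabanUV.Beta.D1BFx.GhostLeg (Ggh)
open Summit.QuantumFields.BalabanUV.Beta.D1BFx.RProjectorJet (RG)
open Summit.QuantumFields.BalabanUV.Beta.D1BFx.GluonLeg (Ga)
open Summit.QuantumFields.BalabanUV.Beta.D1BFx.RJetAssembly (dSw)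
open Summit.QuantumFields.BalabanUV.Beta.D1BFx.GluonNeedleSplit (dipPiece)
open Summit.QuantumFields.BalabanUV.Beta.D1BFx.RankOneBubble (applyK pairing pairing_comm)
open Summit.QuantumFields.BalabanUV.Beta.D1BFx.RankOneBubbleJets (grad tensor loc_dSw_tensor)
open Summit.QuantumFields.BalabanUV.Beta.D1BFx.NeedleDipShape (locV_rho locV_drho locV_p locV_dp loc_dipPiece' bubble_dip_dSw bubble_dip_expand_right)

/-! ## §1 Two pieces of real bookkeeping -/

/-- [folklore] `|a₁b₁ + a₂b₂ − a₃b₃ − a₄b₄| ≤ |a₁||b₁| + |a₂||b₂| + |a₃||b₃| + |a₄||b₄|`. -/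
theorem abs_comb4_le (a₁ b₁ a₂ b₂ a₃ b₃ a₄ b₄ : ℝ) :
    |a₁ * b₁ + a₂ * b₂ - a₃ * b₃ - a₄ * b₄| ≤ |a₁| * |b₁| + |a₂| * |b₂| + |a₃| * |b₃| + |a₄| * |b₄| := by
  calc |a₁ * b₁ + a₂ * b₂ - a₃ * b₃ - a₄ * b₄| ≤ |a₁ * b₁ + a₂ * b₂ - a₃ * b₃| + |a₄ * b₄| := abs_sub _ _
    _ ≤ |a₁ * b₁ + a₂ * b₂| + |a₃ * b₃| + |a₄ * b₄| := by gcongr; exact abs_sub _ _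
    _ ≤ |a₁ * b₁| + |a₂ * b₂| + |a₃ * b₃| + |a₄ * b₄| := by gcongr; exact abs_add_le _ _
    _ = |a₁| * |b₁| + |a₂| * |b₂| + |a₃| * |b₃| + |a₄| * |b₄| := by rw [abs_mul, abs_mul, abs_mul, abs_mul]

/-- [folklore] two damped letters multiply to one: `|a| ≤ X·E`, `|b| ≤ X′·E`, `0 ≤ E ≤ 1`, `X, X′ ≥ 0` ⇒ `|a|·|b| ≤ X·X′·E`. -/
theorem mul_damped_le {a b X X' E : ℝ} (hX : 0 ≤ X) (hX' : 0 ≤ X') (hE : 0 ≤ E) (hE1 : E ≤ 1) (ha : |a| ≤ X * E) (hb : |b| ≤ X' * E) :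
    |a| * |b| ≤ X * X' * E := by
  calc |a| * |b| ≤ (X * E) * (X' * E) := mul_le_mul ha hb (abs_nonneg _) (by positivity)
    _ = X * X' * E * E := by ring
    _ ≤ X * X' * E := mul_le_of_le_one_right (by positivity) hE1

/-- [folklore] a damped letter times a plain bound: `|a| ≤ X·E`, `|b| ≤ Y`, `X ≥ 0` ⇒ `|a|·|b| ≤ X·Y·E` (and symmetrically). -/
theorem mul_damped_plain_le {a b X Y E : ℝ} (hX : 0 ≤ X) (hE : 0 ≤ E) (ha : |a| ≤ X * E) (hb : |b| ≤ Y) :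
    |a| * |b| ≤ X * Y * E ∧ |b| * |a| ≤ X * Y * E := by
  have h : |a| * |b| ≤ X * Y * E := by
    calc |a| * |b| ≤ (X * E) * Y := mul_le_mul ha hb (abs_nonneg _) (by positivity)
      _ = X * Y * E := by ring
  exact ⟨h, by rw [mul_comm]; exact h⟩

/-! ## §2 The sixteen terms in three shapes -/

/-- [folklore] **THE `dip ⊗ dip` WORD, POINTWISE, FROM ABSTRACT PAIRING LETTERS.**  Over the spread leg `Ga n a` (`a > 0`), with damped letters
`X·e^{−(η∕n)‖u−v‖}` for the twelve pairing types with a flat partner and the Coulomb letters `Y₁ + Y₂∕nrm`, `Y₃∕nrm`, `Y₄∕nrm² + Y₅` for `(ρ,ρ′)`,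
`(ρ,δρ′)`∕`(δρ,ρ′)`, `(δρ,δρ′)` (all hypotheses, every bond pair):
`|bubble (Ga n a) (dipPiece n a μ u) (dipPiece n a ν v)| ≤ Z₀·E + Z₁·E∕nrm(u−v) + Z₂·E∕nrm(u−v)²`, `E = e^{−(η∕n)‖u−v‖∞}`. -/
theorem abs_dipDip_word_le (n : ℕ) [NeZero n] (a : ℝ) (ha : 0 < a) (hA : Spr (Ga n a))
    {η XPP XPdP XdPP XdPdP XpR XdPR XpD XdPD XRP XRdP XDP XDdP Y₁ Y₂ Y₃ Y₄ Y₅ : ℝ} (hη : 0 ≤ η)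
    (h0 : 0 ≤ XPP ∧ 0 ≤ XPdP ∧ 0 ≤ XdPP ∧ 0 ≤ XdPdP ∧ 0 ≤ XpR ∧ 0 ≤ XdPR ∧ 0 ≤ XpD ∧ 0 ≤ XdPD ∧ 0 ≤ XRP ∧ 0 ≤ XRdP ∧ 0 ≤ XDP ∧ 0 ≤ XDdP)
    (hPP : ∀ u v : Site 4, |pairing (grad (fun q => Pgt n a u q () ())) (applyK (Ga n a) (grad (fun q => Pgt n a v q () ())))| ≤ XPP * Real.exp (-(η / n) * supNorm (u - v)))
    (hPdP : ∀ (u v : Site 4) (κ' : Fin 4), |pairing (grad (fun q => Pgt n a u q () ())) (applyK (Ga n a) (grad (fun q => Pgt n a v q () () - Pgt n a (v + unitVec κ') q () ())))| ≤ XPdP * Real.exp (-(η / n) * supNorm (u - v)))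
    (hdPP : ∀ (u v : Site 4) (κ : Fin 4), |pairing (grad (fun q => Pgt n a u q () () - Pgt n a (u + unitVec κ) q () ())) (applyK (Ga n a) (grad (fun q => Pgt n a v q () ())))| ≤ XdPP * Real.exp (-(η / n) * supNorm (u - v)))
    (hdPdP : ∀ (u v : Site 4) (κ κ' : Fin 4), |pairing (grad (fun q => Pgt n a u q () () - Pgt n a (u + unitVec κ) q () ())) (applyK (Ga n a) (grad (fun q => Pgt n a v q () () - Pgt n a (v + unitVec κ') q () ())))| ≤ XdPdP * Real.exp (-(η / n) * supNorm (u - v)))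
    (hpR : ∀ u v : Site 4, |pairing (grad (fun q => Pgt n a u q () ())) (applyK (Ga n a) (grad (fun x => RG (Ggh n a) (Pgt n a) x v () ())))| ≤ XpR * Real.exp (-(η / n) * supNorm (u - v)))
    (hdPR : ∀ (u v : Site 4) (κ : Fin 4), |pairing (grad (fun q => Pgt n a u q () () - Pgt n a (u + unitVec κ) q () ())) (applyK (Ga n a) (grad (fun x => RG (Ggh n a) (Pgt n a) x v () ())))| ≤ XdPR * Real.exp (-(η / n) * supNorm (u - v)))
    (hpD : ∀ (u v : Site 4) (κ' : Fin 4), |pairing (grad (fun q => Pgt n a u q () ())) (applyK (Ga n a) (grad (fun x => RG (Ggh n a) (Pgt n a) x (v + unitVec κ') () () - RG (Ggh n a) (Pgt n a) x v () ())))| ≤ XpD * Real.exp (-(η / n) * supNorm (u - v)))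
    (hdPD : ∀ (u v : Site 4) (κ κ' : Fin 4), |pairing (grad (fun q => Pgt n a u q () () - Pgt n a (u + unitVec κ) q () ())) (applyK (Ga n a) (grad (fun x => RG (Ggh n a) (Pgt n a) x (v + unitVec κ') () () - RG (Ggh n a) (Pgt n a) x v () ())))| ≤ XdPD * Real.exp (-(η / n) * supNorm (u - v)))
    (hRP : ∀ u v : Site 4, |pairing (grad (fun x => RG (Ggh n a) (Pgt n a) x u () ())) (applyK (Ga n a) (grad (fun q => Pgt n a v q () ())))| ≤ XRP * Real.exp (-(η / n) * supNorm (u - v)))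
    (hRdP : ∀ (u v : Site 4) (κ' : Fin 4), |pairing (grad (fun x => RG (Ggh n a) (Pgt n a) x u () ())) (applyK (Ga n a) (grad (fun q => Pgt n a v q () () - Pgt n a (v + unitVec κ') q () ())))| ≤ XRdP * Real.exp (-(η / n) * supNorm (u - v)))
    (hDP : ∀ (u v : Site 4) (κ : Fin 4), |pairing (grad (fun x => RG (Ggh n a) (Pgt n a) x (u + unitVec κ) () () - RG (Ggh n a) (Pgt n a) x u () ())) (applyK (Ga n a) (grad (fun q => Pgt n a v q () ())))| ≤ XDP * Real.exp (-(η / n) * supNorm (u - v)))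
    (hDdP : ∀ (u v : Site 4) (κ κ' : Fin 4), |pairing (grad (fun x => RG (Ggh n a) (Pgt n a) x (u + unitVec κ) () () - RG (Ggh n a) (Pgt n a) x u () ())) (applyK (Ga n a) (grad (fun q => Pgt n a v q () () - Pgt n a (v + unitVec κ') q () ())))| ≤ XDdP * Real.exp (-(η / n) * supNorm (u - v)))
    (hRR : ∀ u v : Site 4, |pairing (grad (fun x => RG (Ggh n a) (Pgt n a) x u () ())) (applyK (Ga n a) (grad (fun x => RG (Ggh n a) (Pgt n a) x v () ())))| ≤ Y₁ + Y₂ / nrm (u - v))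
    (hRD : ∀ (u v : Site 4) (κ' : Fin 4), |pairing (grad (fun x => RG (Ggh n a) (Pgt n a) x u () ())) (applyK (Ga n a) (grad (fun x => RG (Ggh n a) (Pgt n a) x (v + unitVec κ') () () - RG (Ggh n a) (Pgt n a) x v () ())))| ≤ Y₃ / nrm (u - v))
    (hDR : ∀ (u v : Site 4) (κ : Fin 4), |pairing (grad (fun x => RG (Ggh n a) (Pgt n a) x (u + unitVec κ) () () - RG (Ggh n a) (Pgt n a) x u () ())) (applyK (Ga n a) (grad (fun x => RG (Ggh n a) (Pgt n a) x v () ())))| ≤ Y₃ / nrm (u - v))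
    (hDD : ∀ (u v : Site 4) (κ κ' : Fin 4), |pairing (grad (fun x => RG (Ggh n a) (Pgt n a) x (u + unitVec κ) () () - RG (Ggh n a) (Pgt n a) x u () ())) (applyK (Ga n a) (grad (fun x => RG (Ggh n a) (Pgt n a) x (v + unitVec κ') () () - RG (Ggh n a) (Pgt n a) x v () ())))| ≤ Y₄ / nrm (u - v) ^ 2 + Y₅)
    (μ ν : Fin 4) (u v : Site 4) :
    |bubble (Ga n a) (dipPiece n a μ u) (dipPiece n a ν v)| ≤
      (XpD * XpD + 2 * XpR * XdPD + 2 * XPP * Y₅ + XdPR * XdPR + 2 * XdPdP * Y₁ + XDP * XDP + 2 * XDdP * XRP + XRdP * XRdP)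
          * Real.exp (-(η / n) * supNorm (u - v))
        + (2 * (XPdP + XdPP) * Y₃ + 2 * XdPdP * Y₂) * Real.exp (-(η / n) * supNorm (u - v)) / nrm (u - v)
        + 2 * XPP * Y₄ * Real.exp (-(η / n) * supNorm (u - v)) / nrm (u - v) ^ 2 := by
  obtain ⟨h0PP, h0PdP, h0dPP, h0dPdP, h0pR, h0dPR, h0pD, h0dPD, h0RP, h0RdP, h0DP, h0DdP⟩ := h0
  -- localisation of the four functions at the base bond
  have l1 := locV_drho n a ν v ha
  have l2 := locV_rho n a v ha
  have l3 := locV_p n a v ha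
  have l4 := locV_dp n a ν v ha
  -- the sixteen terms
  rw [bubble_dip_expand_right ha hA (loc_dipPiece' n a μ u ha) ν v, bubble_dip_dSw ha hA l1 l3, bubble_dip_dSw ha hA l2 l4,
    bubble_dip_dSw ha hA l3 l1, bubble_dip_dSw ha hA l4 l2]
  -- the decay factor and the symmetric readings
  set E : ℝ := Real.exp (-(η / n) * supNorm (u - v)) with hE
  have hE0 : 0 ≤ E := (Real.exp_pos _).le
  have hE1 : E ≤ 1 := by
    rw [hE, Real.exp_le_one_iff]
    have hn : (0 : ℝ) ≤ η / n := div_nonneg hη (Nat.cast_nonneg n)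
    have : (0 : ℝ) ≤ η / n * supNorm (u - v) := mul_nonneg hn (Nat.cast_nonneg _)
    linarith
  have esym : Real.exp (-(η / n) * supNorm (v - u)) = E := by rw [hE, ← neg_sub u v, supNorm_neg]
  have nsym : nrm (v - u) = nrm (u - v) := by rw [← neg_sub u v, nrm_neg]
  have hnrm := nrm_pos (d := 4) (u - v)
  -- the 𝒫-factors (orientation u → v)
  have p11 := hpD u v ν
  have p12 := hdPD u v μ ν
  have p13 := hDD u v μ ν
  have p14 := hRD u v ν
  have p21 := hpR u v
  have p22 := hdPR u v μ
  have p23 := hDR u v μ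
  have p24 := hRR u v
  have p31 := hPP u v
  have p32 := hdPP u v μ
  have p33 := hDP u v μ
  have p34 := hRP u v
  have p41 := hPdP u v ν
  have p42 := hdPdP u v μ ν
  have p43 := hDdP u v μ ν
  have p44 := hRdP u v ν
  -- the 𝒬-factors (orientation v → u, read through `pairing_comm` and the symmetries)
  have q11 : |pairing (applyK (Ga n a) (grad (fun x => RG (Ggh n a) (Pgt n a) x (u + unitVec μ) () () - RG (Ggh n a) (Pgt n a) x u () ()))) (grad (fun q => Pgt n a v q () ()))| ≤ XpD * E := by
    rw [pairing_comm, ← esym]; exact hpD v u μ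
  have q12 : |pairing (applyK (Ga n a) (grad (fun x => RG (Ggh n a) (Pgt n a) x u () ()))) (grad (fun q => Pgt n a v q () ()))| ≤ XpR * E := by
    rw [pairing_comm, ← esym]; exact hpR v u
  have q13 : |pairing (applyK (Ga n a) (grad (fun q => Pgt n a u q () ()))) (grad (fun q => Pgt n a v q () ()))| ≤ XPP * E := by
    rw [pairing_comm, ← esym]; exact hPP v u
  have q14 : |pairing (applyK (Ga n a) (grad (fun q => Pgt n a u q () () - Pgt n a (u + unitVec μ) q () ()))) (grad (fun q => Pgt n a v q () ()))| ≤ XPdP * E := by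
    rw [pairing_comm, ← esym]; exact hPdP v u μ
  have q21 : |pairing (applyK (Ga n a) (grad (fun x => RG (Ggh n a) (Pgt n a) x (u + unitVec μ) () () - RG (Ggh n a) (Pgt n a) x u () ()))) (grad (fun q => Pgt n a v q () () - Pgt n a (v + unitVec ν) q () ()))| ≤ XdPD * E := by
    rw [pairing_comm, ← esym]; exact hdPD v u ν μ
  have q22 : |pairing (applyK (Ga n a) (grad (fun x => RG (Ggh n a) (Pgt n a) x u () ()))) (grad (fun q => Pgt n a v q () () - Pgt n a (v + unitVec ν) q () ()))| ≤ XdPR * E := by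
    rw [pairing_comm, ← esym]; exact hdPR v u ν
  have q23 : |pairing (applyK (Ga n a) (grad (fun q => Pgt n a u q () ()))) (grad (fun q => Pgt n a v q () () - Pgt n a (v + unitVec ν) q () ()))| ≤ XdPP * E := by
    rw [pairing_comm, ← esym]; exact hdPP v u ν
  have q24 : |pairing (applyK (Ga n a) (grad (fun q => Pgt n a u q () () - Pgt n a (u + unitVec μ) q () ()))) (grad (fun q => Pgt n a v q () () - Pgt n a (v + unitVec ν) q () ()))| ≤ XdPdP * E := by
    rw [pairing_comm, ← esym]; exact hdPdP v u ν μ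
  have q31 : |pairing (applyK (Ga n a) (grad (fun x => RG (Ggh n a) (Pgt n a) x (u + unitVec μ) () () - RG (Ggh n a) (Pgt n a) x u () ()))) (grad (fun x => RG (Ggh n a) (Pgt n a) x (v + unitVec ν) () () - RG (Ggh n a) (Pgt n a) x v () ()))| ≤ Y₄ / nrm (u - v) ^ 2 + Y₅ := by
    rw [pairing_comm, ← nsym]; exact hDD v u ν μ
  have q32 : |pairing (applyK (Ga n a) (grad (fun x => RG (Ggh n a) (Pgt n a) x u () ()))) (grad (fun x => RG (Ggh n a) (Pgt n a) x (v + unitVec ν) () () - RG (Ggh n a) (Pgt n a) x v () ()))| ≤ Y₃ / nrm (u - v) := by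
    rw [pairing_comm, ← nsym]; exact hDR v u ν
  have q33 : |pairing (applyK (Ga n a) (grad (fun q => Pgt n a u q () ()))) (grad (fun x => RG (Ggh n a) (Pgt n a) x (v + unitVec ν) () () - RG (Ggh n a) (Pgt n a) x v () ()))| ≤ XDP * E := by
    rw [pairing_comm, ← esym]; exact hDP v u ν
  have q34 : |pairing (applyK (Ga n a) (grad (fun q => Pgt n a u q () () - Pgt n a (u + unitVec μ) q () ()))) (grad (fun x => RG (Ggh n a) (Pgt n a) x (v + unitVec ν) () () - RG (Ggh n a) (Pgt n a) x v () ()))| ≤ XDdP * E := by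
    rw [pairing_comm, ← esym]; exact hDdP v u ν μ
  have q41 : |pairing (applyK (Ga n a) (grad (fun x => RG (Ggh n a) (Pgt n a) x (u + unitVec μ) () () - RG (Ggh n a) (Pgt n a) x u () ()))) (grad (fun x => RG (Ggh n a) (Pgt n a) x v () ()))| ≤ Y₃ / nrm (u - v) := by
    rw [pairing_comm, ← nsym]; exact hRD v u μ
  have q42 : |pairing (applyK (Ga n a) (grad (fun x => RG (Ggh n a) (Pgt n a) x u () ()))) (grad (fun x => RG (Ggh n a) (Pgt n a) x v () ()))| ≤ Y₁ + Y₂ / nrm (u - v) := by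
    rw [pairing_comm, ← nsym]; exact hRR v u
  have q43 : |pairing (applyK (Ga n a) (grad (fun q => Pgt n a u q () ()))) (grad (fun x => RG (Ggh n a) (Pgt n a) x v () ()))| ≤ XRP * E := by
    rw [pairing_comm, ← esym]; exact hRP v u
  have q44 : |pairing (applyK (Ga n a) (grad (fun q => Pgt n a u q () () - Pgt n a (u + unitVec μ) q () ()))) (grad (fun x => RG (Ggh n a) (Pgt n a) x v () ()))| ≤ XRdP * E := by
    rw [pairing_comm, ← esym]; exact hRdP v u μ
  -- the sixteen products
  have t11 := mul_damped_le h0pD h0pD hE0 hE1 p11 q11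
  have t12 := mul_damped_le h0dPD h0pR hE0 hE1 p12 q12
  have t13 := (mul_damped_plain_le h0PP hE0 q13 p13).2
  have t14 := (mul_damped_plain_le h0PdP hE0 q14 p14).2
  have t21 := mul_damped_le h0pR h0dPD hE0 hE1 p21 q21
  have t22 := mul_damped_le h0dPR h0dPR hE0 hE1 p22 q22
  have t23 := (mul_damped_plain_le h0dPP hE0 q23 p23).2
  have t24 := (mul_damped_plain_le h0dPdP hE0 q24 p24).2
  have t31 := (mul_damped_plain_le h0PP hE0 p31 q31).1
  have t32 := (mul_damped_plain_le h0dPP hE0 p32 q32).1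
  have t33 := mul_damped_le h0DP h0DP hE0 hE1 p33 q33
  have t34 := mul_damped_le h0RP h0DdP hE0 hE1 p34 q34
  have t41 := (mul_damped_plain_le h0PdP hE0 p41 q41).1
  have t42 := (mul_damped_plain_le h0dPdP hE0 p42 q42).1
  have t43 := mul_damped_le h0DdP h0RP hE0 hE1 p43 q43
  have t44 := mul_damped_le h0RdP h0RdP hE0 hE1 p44 q44
  -- the four blocks and the total
  have w1 := abs_comb4_le (pairing (grad (fun q => Pgt n a u q () ())) (applyK (Ga n a) (grad (fun x => RG (Ggh n a) (Pgt n a) x (v + unitVec ν) () () - RG (Ggh n a) (Pgt n a) x v () ())))) (pairing (applyK (Ga n a) (grad (fun x => RG (Ggh n a) (Pgt n a) x (u + unitVec μ) () () - RG (Ggh n a) (Pgt n a) x u () ()))) (grad (fun q => Pgt n a v q () ())))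
    (pairing (grad (fun q => Pgt n a u q () () - Pgt n a (u + unitVec μ) q () ())) (applyK (Ga n a) (grad (fun x => RG (Ggh n a) (Pgt n a) x (v + unitVec ν) () () - RG (Ggh n a) (Pgt n a) x v () ())))) (pairing (applyK (Ga n a) (grad (fun x => RG (Ggh n a) (Pgt n a) x u () ()))) (grad (fun q => Pgt n a v q () ())))
    (pairing (grad (fun x => RG (Ggh n a) (Pgt n a) x (u + unitVec μ) () () - RG (Ggh n a) (Pgt n a) x u () ())) (applyK (Ga n a) (grad (fun x => RG (Ggh n a) (Pgt n a) x (v + unitVec ν) () () - RG (Ggh n a) (Pgt n a) x v () ())))) (pairing (applyK (Ga n a) (grad (fun q => Pgt n a u q () ()))) (grad (fun q => Pgt n a v q () ())))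
    (pairing (grad (fun x => RG (Ggh n a) (Pgt n a) x u () ())) (applyK (Ga n a) (grad (fun x => RG (Ggh n a) (Pgt n a) x (v + unitVec ν) () () - RG (Ggh n a) (Pgt n a) x v () ())))) (pairing (applyK (Ga n a) (grad (fun q => Pgt n a u q () () - Pgt n a (u + unitVec μ) q () ()))) (grad (fun q => Pgt n a v q () ())))
  have w2 := abs_comb4_le (pairing (grad (fun q => Pgt n a u q () ())) (applyK (Ga n a) (grad (fun x => RG (Ggh n a) (Pgt n a) x v () ())))) (pairing (applyK (Ga n a) (grad (fun x => RG (Ggh n a) (Pgt n a) x (u + unitVec μ) () () - RG (Ggh n a) (Pgt n a) x u () ()))) (grad (fun q => Pgt n a v q () () - Pgt n a (v + unitVec ν) q () ())))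
    (pairing (grad (fun q => Pgt n a u q () () - Pgt n a (u + unitVec μ) q () ())) (applyK (Ga n a) (grad (fun x => RG (Ggh n a) (Pgt n a) x v () ())))) (pairing (applyK (Ga n a) (grad (fun x => RG (Ggh n a) (Pgt n a) x u () ()))) (grad (fun q => Pgt n a v q () () - Pgt n a (v + unitVec ν) q () ())))
    (pairing (grad (fun x => RG (Ggh n a) (Pgt n a) x (u + unitVec μ) () () - RG (Ggh n a) (Pgt n a) x u () ())) (applyK (Ga n a) (grad (fun x => RG (Ggh n a) (Pgt n a) x v () ())))) (pairing (applyK (Ga n a) (grad (fun q => Pgt n a u q () ()))) (grad (fun q => Pgt n a v q () () - Pgt n a (v + unitVec ν) q () ())))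
    (pairing (grad (fun x => RG (Ggh n a) (Pgt n a) x u () ())) (applyK (Ga n a) (grad (fun x => RG (Ggh n a) (Pgt n a) x v () ())))) (pairing (applyK (Ga n a) (grad (fun q => Pgt n a u q () () - Pgt n a (u + unitVec μ) q () ()))) (grad (fun q => Pgt n a v q () () - Pgt n a (v + unitVec ν) q () ())))
  have w3 := abs_comb4_le (pairing (grad (fun q => Pgt n a u q () ())) (applyK (Ga n a) (grad (fun q => Pgt n a v q () ())))) (pairing (applyK (Ga n a) (grad (fun x => RG (Ggh n a) (Pgt n a) x (u + unitVec μ) () () - RG (Ggh n a) (Pgt n a) x u () ()))) (grad (fun x => RG (Ggh n a) (Pgt n a) x (v + unitVec ν) () () - RG (Ggh n a) (Pgt n a) x v () ())))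
    (pairing (grad (fun q => Pgt n a u q () () - Pgt n a (u + unitVec μ) q () ())) (applyK (Ga n a) (grad (fun q => Pgt n a v q () ())))) (pairing (applyK (Ga n a) (grad (fun x => RG (Ggh n a) (Pgt n a) x u () ()))) (grad (fun x => RG (Ggh n a) (Pgt n a) x (v + unitVec ν) () () - RG (Ggh n a) (Pgt n a) x v () ())))
    (pairing (grad (fun x => RG (Ggh n a) (Pgt n a) x (u + unitVec μ) () () - RG (Ggh n a) (Pgt n a) x u () ())) (applyK (Ga n a) (grad (fun q => Pgt n a v q () ())))) (pairing (applyK (Ga n a) (grad (fun q => Pgt n a u q () ()))) (grad (fun x => RG (Ggh n a) (Pgt n a) x (v + unitVec ν) () () - RG (Ggh n a) (Pgt n a) x v () ())))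
    (pairing (grad (fun x => RG (Ggh n a) (Pgt n a) x u () ())) (applyK (Ga n a) (grad (fun q => Pgt n a v q () ())))) (pairing (applyK (Ga n a) (grad (fun q => Pgt n a u q () () - Pgt n a (u + unitVec μ) q () ()))) (grad (fun x => RG (Ggh n a) (Pgt n a) x (v + unitVec ν) () () - RG (Ggh n a) (Pgt n a) x v () ())))
  have w4 := abs_comb4_le (pairing (grad (fun q => Pgt n a u q () ())) (applyK (Ga n a) (grad (fun q => Pgt n a v q () () - Pgt n a (v + unitVec ν) q () ())))) (pairing (applyK (Ga n a) (grad (fun x => RG (Ggh n a) (Pgt n a) x (u + unitVec μ) () () - RG (Ggh n a) (Pgt n a) x u () ()))) (grad (fun x => RG (Ggh n a) (Pgt n a) x v () ())))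
    (pairing (grad (fun q => Pgt n a u q () () - Pgt n a (u + unitVec μ) q () ())) (applyK (Ga n a) (grad (fun q => Pgt n a v q () () - Pgt n a (v + unitVec ν) q () ())))) (pairing (applyK (Ga n a) (grad (fun x => RG (Ggh n a) (Pgt n a) x u () ()))) (grad (fun x => RG (Ggh n a) (Pgt n a) x v () ())))
    (pairing (grad (fun x => RG (Ggh n a) (Pgt n a) x (u + unitVec μ) () () - RG (Ggh n a) (Pgt n a) x u () ())) (applyK (Ga n a) (grad (fun q => Pgt n a v q () () - Pgt n a (v + unitVec ν) q () ())))) (pairing (applyK (Ga n a) (grad (fun q => Pgt n a u q () ()))) (grad (fun x => RG (Ggh n a) (Pgt n a) x v () ())))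
    (pairing (grad (fun x => RG (Ggh n a) (Pgt n a) x u () ())) (applyK (Ga n a) (grad (fun q => Pgt n a v q () () - Pgt n a (v + unitVec ν) q () ())))) (pairing (applyK (Ga n a) (grad (fun q => Pgt n a u q () () - Pgt n a (u + unitVec μ) q () ()))) (grad (fun x => RG (Ggh n a) (Pgt n a) x v () ())))
  have htot := fun (W₁ W₂ W₃ W₄ : ℝ) => show |W₁ + W₂ - W₃ - W₄| ≤ |W₁| + |W₂| + |W₃| + |W₄| from
    (abs_sub _ _).trans (add_le_add ((abs_sub _ _).trans (add_le_add (abs_add_le _ _) le_rfl)) le_rfl)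
  refine (htot _ _ _ _).trans ?_
  refine (add_le_add (add_le_add (add_le_add (w1.trans (add_le_add (add_le_add (add_le_add t11 t12) t13) t14))
    (w2.trans (add_le_add (add_le_add (add_le_add t21 t22) t23) t24))) (w3.trans (add_le_add (add_le_add (add_le_add t31 t32) t33) t34)))
    (w4.trans (add_le_add (add_le_add (add_le_add t41 t42) t43) t44))).trans (le_of_eq ?_)
  ring

end Summit.QuantumFields.BalabanUV.Beta.D1BFx.NeedleDipDipPointwise

end
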